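import Summits.Ventures.HodgeRepro2.A2PrimitiveNumbers
import Summits.Ventures.HodgeRepro2.A2HodgeNumbers

/-!
# A2PrimitiveHodge — the Lefschetz decomposition respects the bigrading: the primitive Hodge
numbers `dim P^{a,b} = h^{a,b} − h^{a−1,b−1}`

Tier-4 annex of sub-claim A2 (seat p6, cell pub-hodge-repro2); §8(d): uses an L-value-free
non-vanishing device: NO.

The bigrading of row 122 has projections `hproj a b` (the coordinates of the monomial basis of
bidegree `(a, b)`); `L = θ ∧ ·` and `Λ` are bigraded of bidegrees `(1,1)` and `(−1,−1)`
(`hproj_lef`, `hproj_lam`), so the unique splitting `x = v + L y` of row 115 of a class `x` of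
bidegree `(a, b)` has `v` of bidegree `(a, b)` and `y` of bidegree `(a−1, b−1)`
(`primPart_mem_hgrading`, `lefPart_mem_hgrading`; `1 ≤ a, b`, `a + b ≤ n`).  Hence the primitive
classes of bidegree `(a, b)`, `P^{a,b} = ker Λ ∩ hgrading a b` (`hprim`), satisfy
`hgrading a b = P^{a,b} ⊕ L (hgrading (a−1) (b−1))` and

  `dim P^{a,b} = C(n,a) C(n,b) − C(n,a−1) C(n,b−1)`   (`finrank_hprim`),

the primitive Hodge numbers (the `(p,q)`-refinement of Voisin Cor. 6.26).  Twelve planes: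
`dim P^{2,2} = 4356 − 144 = 4212`, `dim P^{1,1} = 144 − 1 = 143` (`finrank_hprim_two_two`,
`finrank_hprim_one_one`) — the Weil classes of Theorem A live in the 4212-dimensional space
of primitive `(2,2)`-classes of the model.

What stays prose: Voisin §6.2 as statements about `H^*(B, ℂ)`; not on the N1 chain.
-/

namespace Summit.Ventures.HodgeRepro2.A2PrimitiveHodge

open WeilPlanes WeilIntegral WeilCoproduct A2ModelDuality A2HardLefschetzOps A2HardLefschetzMain
  A2LefschetzSplitting A2HodgeTypeModel A2HodgeBigrading A2PrimitiveNumbers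

variable {ι : Type*} [DecidableEq ι] [Fintype ι]

/-! ### The projections of the bigrading -/

/-- The projection onto the bidegree `(a, b)` along the other bidegrees (the coordinates of the
monomial basis of bidegree `(a, b)`). -/
noncomputable def hproj (a b : ℕ) : A ι →ₗ[ℂ] A ι :=
  aBasis.constr ℂ fun s => if bideg s = (a, b) then aBasis s else 0

omit [DecidableEq ι] in
/-- `hproj a b e_s = e_s` if `bideg s = (a, b)`, else `0`. -/
theorem hproj_aBasis (a b : ℕ) (s : Finset (Fin (Fintype.card (Gen ι)))) :
    hproj a b (aBasis s) = if bideg s = (a, b) then aBasis s else 0 := by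
  simp only [hproj]
  exact aBasis.constr_basis ℂ _ s

/-- `hproj a b x ∈ hgrading a b`. -/
theorem hproj_mem (a b : ℕ) (x : A ι) : hproj a b x ∈ hgrading a b := by
  rw [← aBasis.sum_repr x, map_sum]
  refine Submodule.sum_mem _ fun s _ => ?_
  rw [map_smul, hproj_aBasis]
  refine Submodule.smul_mem _ _ ?_
  split_ifs with hs
  · have := aBasis_mem_hgrading s
    rwa [hs] at this
  · exact Submodule.zero_mem _

/-- On `hgrading a' b'` the projection `hproj a b` is the identity if `(a', b') = (a, b)` and `0`
otherwise. -/
theorem hproj_of_mem {a' b' : ℕ} {x : A ι} (hx : x ∈ hgrading a' b') (a b : ℕ) :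
    hproj a b x = if (a', b') = (a, b) then x else 0 := by
  rw [hgrading_eq_span] at hx
  refine Submodule.span_induction (p := fun x _ => hproj a b x = if (a', b') = (a, b) then x else 0)
    ?_ ?_ ?_ ?_ hx
  · rintro _ ⟨s, hs, rfl⟩
    rw [Set.mem_setOf_eq] at hs
    rw [hproj_aBasis, hs]
  · rw [map_zero]
    split_ifs <;> rfl
  · intro x y _ _ hx hy
    rw [map_add, hx, hy]
    split_ifs <;> simp
  · intro r x _ hx
    rw [map_smul, hx]
    split_ifs <;> simp

/-- `hproj a b x = x` for `x ∈ hgrading a b`. -/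
theorem hproj_of_mem_self {a b : ℕ} {x : A ι} (hx : x ∈ hgrading a b) : hproj a b x = x := by
  rw [hproj_of_mem hx, if_pos rfl]

/-- `Λ` kills the classes of bidegree `(0, b)` (no generator of the first kind to contract). -/
theorem lam_eq_zero_of_mem_zero_left (c : ι → ℂ) {b : ℕ} {x : A ι} (hx : x ∈ hgrading 0 b) :
    lam c x = 0 := by
  rw [hgrading_eq_span] at hx
  refine Submodule.span_induction (p := fun x _ => lam c x = 0) ?_ ?_ ?_ ?_ hx
  · rintro _ ⟨s, hs, rfl⟩
    rw [Set.mem_setOf_eq] at hs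
    rw [aBasis_apply]
    simp only [lam, LinearMap.sum_apply, LinearMap.smul_apply]
    refine Finset.sum_eq_zero fun p _ => ?_
    have hnot : (p, false) ∉ genListOf s := by
      intro hmem
      have h0 : cA (genListOf s) = 0 := congrArg Prod.fst hs
      rw [cA, List.countP_eq_zero] at h0
      exact absurd (h0 _ hmem) (by simp)
    show (c p)⁻¹ • contr (dual (p, true)) (contr (dual (p, false)) (mono (genListOf s))) = 0
    rw [contr_dual_mono_of_notMem hnot, map_zero, smul_zero]
  · exact map_zero _
  · intro x y _ _ hx hy
    rw [map_add, hx, hy, add_zero]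
  · intro r x _ hx
    rw [map_smul, hx, smul_zero]

/-- `Λ` kills the classes of bidegree `(a, 0)` (no generator of the second kind to contract). -/
theorem lam_eq_zero_of_mem_zero_right (c : ι → ℂ) {a : ℕ} {x : A ι} (hx : x ∈ hgrading a 0) :
    lam c x = 0 := by
  rw [hgrading_eq_span] at hx
  refine Submodule.span_induction (p := fun x _ => lam c x = 0) ?_ ?_ ?_ ?_ hx
  · rintro _ ⟨s, hs, rfl⟩
    rw [Set.mem_setOf_eq] at hs
    rw [aBasis_apply]
    simp only [lam, LinearMap.sum_apply, LinearMap.smul_apply]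
    refine Finset.sum_eq_zero fun p _ => ?_
    have hnot : (p, true) ∉ genListOf s := by
      intro hmem
      have h0 : cB (genListOf s) = 0 := congrArg Prod.snd hs
      rw [cB, List.countP_eq_zero] at h0
      exact absurd (h0 _ hmem) (by simp)
    show (c p)⁻¹ • contr (dual (p, true)) (contr (dual (p, false)) (mono (genListOf s))) = 0
    by_cases hmem : (p, false) ∈ genListOf s
    · obtain ⟨ε, -, h⟩ := contr_dual_mono_of_mem (A2LamAdjoint.genListOf_nodup s) hmem
      rw [h, map_smul, contr_dual_mono_of_notMem (fun h' => hnot (List.mem_of_mem_erase h')),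
        smul_zero, smul_zero]
    · rw [contr_dual_mono_of_notMem hmem, map_zero, smul_zero]
  · exact map_zero _
  · intro x y _ _ hx hy
    rw [map_add, hx, hy, add_zero]
  · intro r x _ hx
    rw [map_smul, hx, smul_zero]

/-- `L` is bigraded of bidegree `(1, 1)`: `hproj (a+1) (b+1) ∘ L = L ∘ hproj a b`. -/
theorem hproj_lef (c : ι → ℂ) (a b : ℕ) (y : A ι) :
    hproj (a + 1) (b + 1) (lef c y) = lef c (hproj a b y) := by
  have key : ∀ s : Finset (Fin (Fintype.card (Gen ι))),
      hproj (a + 1) (b + 1) (lef c (aBasis s)) = lef c (hproj a b (aBasis s)) := by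
    intro s
    have hs := aBasis_mem_hgrading s
    have hL : lef c (aBasis s) ∈ hgrading (1 + (bideg s).1) (1 + (bideg s).2) :=
      mul_mem_hgrading (theta_mem_hgrading c) hs
    rw [hproj_of_mem hL, hproj_of_mem hs]
    by_cases h : bideg s = (a, b)
    · rw [if_pos (by rw [h]; simp only [Prod.mk.injEq]; omega), if_pos h]
    · rw [if_neg, if_neg h, map_zero]
      intro h'
      apply h
      rw [Prod.mk.injEq] at h' ⊢
      omega
  have h : (hproj (a + 1) (b + 1) ∘ₗ lef c : A ι →ₗ[ℂ] A ι) = lef c ∘ₗ hproj a b := by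
    refine aBasis.ext fun s => ?_
    simp only [LinearMap.comp_apply]
    exact key s
  have := LinearMap.congr_fun h y
  simpa only [LinearMap.comp_apply] using this

/-- `Λ` is bigraded of bidegree `(−1, −1)`: `hproj a b ∘ Λ = Λ ∘ hproj (a+1) (b+1)`. -/
theorem hproj_lam (c : ι → ℂ) (a b : ℕ) (v : A ι) :
    hproj a b (lam c v) = lam c (hproj (a + 1) (b + 1) v) := by
  have key : ∀ s : Finset (Fin (Fintype.card (Gen ι))),
      hproj a b (lam c (aBasis s)) = lam c (hproj (a + 1) (b + 1) (aBasis s)) := by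
    intro s
    have hs := aBasis_mem_hgrading s
    rw [hproj_of_mem hs]
    rcases hA : (bideg s).1 with _ | a'
    · rw [lam_eq_zero_of_mem_zero_left c (hA ▸ hs), map_zero, if_neg, map_zero]
      rw [Prod.mk.injEq]
      omega
    rcases hB : (bideg s).2 with _ | b'
    · rw [lam_eq_zero_of_mem_zero_right c (hB ▸ hs), map_zero, if_neg, map_zero]
      rw [Prod.mk.injEq]
      omega
    have hs' : aBasis s ∈ hgrading (a' + 1) (b' + 1) := by rwa [hA, hB] at hs
    have hΛ := lam_mem_hgrading c hs'
    rw [hproj_of_mem hΛ]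
    by_cases h : (a', b') = (a, b)
    · rw [if_pos h, if_pos (by rw [Prod.mk.injEq] at h ⊢; omega)]
    · rw [if_neg h, if_neg (by rw [Prod.mk.injEq] at h ⊢; omega), map_zero]
  have h : (hproj a b ∘ₗ lam c : A ι →ₗ[ℂ] A ι) = lam c ∘ₗ hproj (a + 1) (b + 1) := by
    refine aBasis.ext fun s => ?_
    simp only [LinearMap.comp_apply]
    exact key s
  have := LinearMap.congr_fun h v
  simpa only [LinearMap.comp_apply] using this

/-! ### The bigraded Lefschetz splitting -/

/-- THE SPLITTING RESPECTS THE BIGRADING: for `x` of bidegree `(a, b)`, `1 ≤ a, b`, `a + b ≤ n`,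
the primitive part of row 115 has bidegree `(a, b)` and the Lefschetz part bidegree
`(a−1, b−1)`. -/
theorem primPart_mem_hgrading (c : ι → ℂ) (hc : ∀ p, c p ≠ 0) {a b : ℕ} (ha : 1 ≤ a) (hb : 1 ≤ b)
    (hk : a + b ≤ Fintype.card ι) {x : A ι} (hx : x ∈ hgrading a b) :
    primPart c hc hk (hgrading_le_grading a b hx) ∈ hgrading a b ∧
      lefPart c hc hk (hgrading_le_grading a b hx) ∈ hgrading (a - 1) (b - 1) := by
  set hx' := hgrading_le_grading a b hx
  set v := primPart c hc hk hx' with hv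
  set y := lefPart c hc hk hx' with hy
  have hxe : x = v + lef c y := primPart_add_lef_lefPart c hc hk hx'
  have hva : lam c v = 0 := lam_primPart c hc hk hx'
  have hya : y ∈ grading ι (a + b - 2) := lefPart_mem c hc hk hx'
  -- project to bidegree `(a, b)`
  have e1 : a - 1 + 1 = a := Nat.sub_add_cancel ha
  have e2 : b - 1 + 1 = b := Nat.sub_add_cancel hb
  have hxp : x = hproj a b v + lef c (hproj (a - 1) (b - 1) y) := by
    conv_lhs => rw [← hproj_of_mem_self hx, hxe]
    rw [map_add]
    congr 1
    conv_lhs => rw [← e1, ← e2]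
    rw [hproj_lef]
  have hv' : lam c (hproj a b v) = 0 := by
    conv_lhs => rw [← e1, ← e2]
    rw [← hproj_lam, hva, map_zero]
  have hy' : hproj (a - 1) (b - 1) y ∈ grading ι (a + b - 2) := by
    have := hgrading_le_grading (a - 1) (b - 1) (hproj_mem (a - 1) (b - 1) y)
    have e : a - 1 + (b - 1) = a + b - 2 := by omega
    rwa [e] at this
  have h2 : 2 ≤ a + b := by omega
  have huniq := primitive_splitting_unique hc h2 hk hva hv' hya hy' (hxe.symm.trans hxp)
  constructor
  · have := hproj_mem a b v
    rwa [← huniq.1] at this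
  · have := hproj_mem (a - 1) (b - 1) y
    rwa [← huniq.2] at this

/-- The primitive classes of bidegree `(a, b)`: `P^{a,b} = ker Λ_c ∩ hgrading a b`. -/
noncomputable def hprim (c : ι → ℂ) (a b : ℕ) : Submodule ℂ (A ι) :=
  LinearMap.ker (lam c) ⊓ hgrading a b

/-- Membership in `P^{a,b}`. -/
theorem mem_hprim {c : ι → ℂ} {a b : ℕ} {x : A ι} :
    x ∈ hprim c a b ↔ lam c x = 0 ∧ x ∈ hgrading a b := by
  simp [hprim]

/-- `hgrading a b = P^{a,b} ⊔ L (hgrading (a−1) (b−1))` for `1 ≤ a, b`, `a + b ≤ n`. -/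
theorem hgrading_eq_hprim_sup_map {c : ι → ℂ} (hc : ∀ p, c p ≠ 0) {a b : ℕ} (ha : 1 ≤ a)
    (hb : 1 ≤ b) (hk : a + b ≤ Fintype.card ι) :
    (hgrading a b : Submodule ℂ (A ι)) = hprim c a b ⊔ (hgrading (a - 1) (b - 1)).map (lef c) := by
  apply le_antisymm
  · intro x hx
    obtain ⟨hv, hy⟩ := primPart_mem_hgrading c hc ha hb hk hx
    rw [primPart_add_lef_lefPart c hc hk (hgrading_le_grading a b hx)]
    refine Submodule.add_mem_sup ?_ (Submodule.mem_map_of_mem hy)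
    rw [mem_hprim]
    exact ⟨lam_primPart c hc hk _, hv⟩
  · refine sup_le inf_le_right ?_
    rintro _ ⟨y, hy, rfl⟩
    have := mul_mem_hgrading (theta_mem_hgrading c) hy
    have e1 : 1 + (a - 1) = a := by omega
    have e2 : 1 + (b - 1) = b := by omega
    rwa [e1, e2] at this

/-- `P^{a,b} ⊓ L (hgrading (a−1) (b−1)) = ⊥`. -/
theorem disjoint_hprim_map {c : ι → ℂ} (hc : ∀ p, c p ≠ 0) {a b : ℕ} (ha : 1 ≤ a) (hb : 1 ≤ b)
    (hk : a + b ≤ Fintype.card ι) :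
    Disjoint (hprim c a b) ((hgrading (a - 1) (b - 1)).map (lef c)) := by
  rw [Submodule.disjoint_def]
  intro v hv hv'
  rw [mem_hprim] at hv
  obtain ⟨y, hy, rfl⟩ := hv'
  have hy' : y ∈ grading ι (a + b - 2) := by
    have := hgrading_le_grading (a - 1) (b - 1) hy
    have e : a - 1 + (b - 1) = a + b - 2 := by omega
    rwa [e] at this
  have h := primitive_splitting_unique hc (by omega) hk (v := lef c y) (v' := 0) (y := 0) (y' := y)
    hv.1 (map_zero _) (Submodule.zero_mem _) hy' (by rw [map_zero, add_zero, zero_add])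
  exact h.1

/-- `dim L (hgrading a' b') = h^{a',b'}` for `a' + b' + 1 ≤ n` (`L` injective there). -/
theorem finrank_map_lef_hgrading {c : ι → ℂ} (hc : ∀ p, c p ≠ 0) {a' b' : ℕ}
    (h : a' + b' + 1 ≤ Fintype.card ι) :
    Module.finrank ℂ ((hgrading (ι := ι) a' b').map (lef c)) =
      (Fintype.card ι).choose a' * (Fintype.card ι).choose b' := by
  rw [← A2HodgeNumbers.finrank_hgrading, ← LinearMap.range_domRestrict]
  refine LinearMap.finrank_range_of_inj fun y y' hyy => ?_
  rw [LinearMap.domRestrict_apply, LinearMap.domRestrict_apply] at hyy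
  have h0 : lef c ((y : A ι) - y') = 0 := by rw [map_sub, hyy, sub_self]
  have hmem : ((y : A ι) - y') ∈ grading ι (a' + b') :=
    hgrading_le_grading a' b' (Submodule.sub_mem _ y.2 y'.2)
  have : ((y : A ι) - y') = 0 := by
    refine eq_zero_of_lef_pow_eq_zero hc hmem (m := 1) h ?_
    rw [pow_one]
    exact h0
  exact Subtype.ext (sub_eq_zero.mp this)

/-- THE PRIMITIVE HODGE NUMBERS OF THE MODEL: `dim P^{a,b} = C(n,a) C(n,b) − C(n,a−1) C(n,b−1)`
for `1 ≤ a, b` and `a + b ≤ n`. -/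
theorem finrank_hprim {c : ι → ℂ} (hc : ∀ p, c p ≠ 0) {a b : ℕ} (ha : 1 ≤ a) (hb : 1 ≤ b)
    (hk : a + b ≤ Fintype.card ι) :
    Module.finrank ℂ (hprim c a b) =
      (Fintype.card ι).choose a * (Fintype.card ι).choose b -
        (Fintype.card ι).choose (a - 1) * (Fintype.card ι).choose (b - 1) := by
  haveI : FiniteDimensional ℂ (hgrading (ι := ι) a b) := by
    haveI := finiteDimensional_grading (ι := ι) (a + b)
    exact Submodule.finiteDimensional_of_le (hgrading_le_grading a b)
  haveI : FiniteDimensional ℂ (hprim c a b) :=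
    Submodule.finiteDimensional_of_le (inf_le_right : hprim c a b ≤ hgrading a b)
  haveI : FiniteDimensional ℂ (hgrading (ι := ι) (a - 1) (b - 1)) := by
    haveI := finiteDimensional_grading (ι := ι) (a - 1 + (b - 1))
    exact Submodule.finiteDimensional_of_le (hgrading_le_grading (a - 1) (b - 1))
  haveI : FiniteDimensional ℂ ((hgrading (a - 1) (b - 1) : Submodule ℂ (A ι)).map (lef c)) :=
    Module.Finite.map _ _
  have h := Submodule.finrank_sup_add_finrank_inf_eq (hprim c a b)
    ((hgrading (a - 1) (b - 1)).map (lef c))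
  rw [← hgrading_eq_hprim_sup_map hc ha hb hk, (disjoint_hprim_map hc ha hb hk).eq_bot,
    finrank_bot, add_zero, A2HodgeNumbers.finrank_hgrading,
    finrank_map_lef_hgrading hc (by omega)] at h
  omega

/-- Twelve planes: `dim P^{2,2} = 66² − 12² = 4212`. -/
theorem finrank_hprim_two_two {c : A2TwelvePlanes.ι₁₂ → ℂ} (hc : ∀ p, c p ≠ 0) :
    Module.finrank ℂ (hprim c 2 2) = 4212 := by
  rw [finrank_hprim hc (by norm_num) (by norm_num) (by rw [A2TwelvePlanes.card_twelve]; norm_num),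
    A2TwelvePlanes.card_twelve]
  decide

/-- Twelve planes: `dim P^{1,1} = 144 − 1 = 143`. -/
theorem finrank_hprim_one_one {c : A2TwelvePlanes.ι₁₂ → ℂ} (hc : ∀ p, c p ≠ 0) :
    Module.finrank ℂ (hprim c 1 1) = 143 := by
  rw [finrank_hprim hc (by norm_num) (by norm_num) (by rw [A2TwelvePlanes.card_twelve]; norm_num),
    A2TwelvePlanes.card_twelve]
  decide

end Summit.Ventures.HodgeRepro2.A2PrimitiveHodge
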